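import Summits.HodgeConjecture.HodgeCM.Model.ToyG2.HodgeRieszCM_1

/-! PORT of `HodgeCM/Model/ToyG2/HodgeRieszCM.lean` (HodgeCMPerL run 82) — part 2: continuation of `Summits.HodgeConjecture.HodgeCM.Model.ToyG2.HodgeRieszCM_1` (split at a top-level declaration boundary by port_pkg.py; scope re-opened below; declarations unchanged). -/

-- port_pkg: scope re-opened for this part (file-level context, then the namespace/section stack open at the cut)
namespace HodgeCM.ToyG2
open HodgeCM.Toy HodgeCM.Toy.CMPresentation
open Literature.AlgebraicGeometry.Motives
open scoped TensorProduct ComplexConjugate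
open exteriorPower Obj₂ Module
noncomputable section
section Complexify
variable (A : Obj)
/-- two `ℂ`-linear maps on `⋀^k_ℂ (ℂ ⊗ L)` agreeing on complexified rational classes are equal -/
lemma ext_theta {M : Type*} [AddCommGroup M] [Module ℂ M] [Module ℚ M] [IsScalarTower ℚ ℂ M] {k : ℕ}
    {f g : ⋀[ℂ]^k A.LC →ₗ[ℂ] M}
    (h : ∀ x : ⋀[ℚ]^k A.L, f (A.Θ k ((1 : ℂ) ⊗ₜ[ℚ] x)) = g (A.Θ k ((1 : ℂ) ⊗ₜ[ℚ] x))) : f = g := by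
  have key : f ∘ₗ (A.Θ k).toLinearMap = g ∘ₗ (A.Θ k).toLinearMap := by
    refine TensorProduct.AlgebraTensorModule.ext fun z x => ?_
    simp only [LinearMap.coe_comp, Function.comp_apply, LinearEquiv.coe_coe]
    rw [theta_tmul', map_smul, map_smul, h]
  refine LinearMap.ext fun y => ?_
  have := LinearMap.congr_fun key ((A.Θ k).symm y)
  simpa using this

end Complexify

/-! ### §7 `HodgeRiesz` for good objects with conjugation data -/

set_option maxHeartbeats 1600000 in
/-- **G3′ (CM case).**  For a good object whose gen-1 object carries conjugation data, every rational functional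
on `⋀⁴ H¹` of Hodge type `(2,2)` that kills the left radical of the trace pairing is represented by a rational
Hodge class of type `(dim - 2, dim - 2)`. -/
theorem hodgeRiesz_of_conjData (X : Obj₂) (hX : X.Good) (C : X.toObj.ConjData) : HodgeRiesz X := by
  intro lam hlam hrad
  by_cases h2 : 2 ≤ X.dim
  swap
  · -- `dim X < 2`: the pairing vanishes, so `lam = 0`
    have hne : sdeg X.s X.leaf ≠ 4 + 2 * (X.dim - 2) := by rw [sdeg_eq]; omega
    refine ⟨0, Submodule.zero_mem _, fun y => ?_⟩
    rw [map_zero, map_zero]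
    exact hrad y (mem_leftRad.mpr fun c => by rw [trOf_of_ne hne, LinearMap.zero_apply])
  -- notation
  set b := 2 * (X.dim - 2) with hb
  set A := X.toObj with hA
  have h4m : 4 + b = 2 * X.dim := by omega
  -- Step 1: the canonical representative over `ℚ`
  let P : (⋀[ℚ]^4 X.L) →ₗ[ℚ] (⋀[ℚ]^b X.L) →ₗ[ℚ] ℚ := trPairing X 4 b
  let S : LinearMap.BilinForm ℚ (⋀[ℚ]^b X.L) := Star.β C.form
  have hSsymm : ∀ x y, S x y = S y x := fun x y => β_symm (form_symm C) x y
  have hS : S.IsRefl := fun x y h => by rw [hSsymm]; exact h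
  have hSR : (S.restrict (rightRad P)).Nondegenerate :=
    restrict_rightRad_nondegenerate_of_anisotropic P S fun w _ hw => β_form_anisotropic C b w hw
  have hφ : ∀ v, (∀ w, P v w = 0) → lam v = 0 := fun v hv => hrad v (mem_leftRad.mpr hv)
  obtain ⟨c, hc1, v₀, hc2⟩ := exists_isCanonRepr P S lam hS hSR hφ
  refine ⟨c, ?_, fun y => (hc1 y).symm⟩
  -- Step 2: complexification
  let trC := baseC A (trOf X (4 + b))
  let P' : (⋀[ℂ]^4 A.LC) →ₗ[ℂ] (⋀[ℂ]^b A.LC) →ₗ[ℂ] ℂ := (wedge ℂ A.LC 4 b).compr₂ trC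
  let S' : LinearMap.BilinForm ℂ (⋀[ℂ]^b A.LC) := Star.β C.formC
  let φ' := baseC A lam
  let c' := A.Θ b ((1 : ℂ) ⊗ₜ[ℚ] c)
  have hP'ap : ∀ v w, P' v w = trC (wedge ℂ A.LC 4 b v w) := fun v w => rfl
  have hc' : IsCanonRepr P' S' φ' c' := by
    refine ⟨fun v' => ?_, ⟨A.Θ 4 ((1 : ℂ) ⊗ₜ[ℚ] v₀), fun w' => ?_⟩⟩
    · have key : P'.flip c' = φ' := by
        refine ext_theta A fun v => ?_
        rw [LinearMap.flip_apply, hP'ap, wedge_theta_one_tmul, baseC_theta_one_tmul, baseC_theta_one_tmul]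
        exact congrArg (fun q : ℚ => (q : ℂ)) (hc1 v)
      exact LinearMap.congr_fun key v'
    · have key : (Star.β (k := b) C.formC).flip c' = P' (A.Θ 4 ((1 : ℂ) ⊗ₜ[ℚ] v₀)) := by
        refine ext_theta A fun w => ?_
        rw [LinearMap.flip_apply, hP'ap, wedge_theta_one_tmul, baseC_theta_one_tmul,
          show Star.β C.formC (A.Θ b ((1 : ℂ) ⊗ₜ[ℚ] w)) c' = Star.β C.formC (A.θ b w) (A.θ b c) by
            rw [← Obj.theta_one_tmul, ← Obj.theta_one_tmul],
          C.β_formC_thetaLin, hc2 w]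
        rfl
      exact LinearMap.congr_fun key w'
  -- Step 3: the symmetries `(2⁻² wt₂, 2^{-(d-2)} wt₂)`
  have h20 : (2 : ℂ) ≠ 0 := two_ne_zero
  have hp4 : ((2 : ℂ) ^ 2)⁻¹ ≠ 0 := inv_ne_zero (pow_ne_zero _ h20)
  have hpm : ((2 : ℂ) ^ (X.dim - 2))⁻¹ ≠ 0 := inv_ne_zero (pow_ne_zero _ h20)
  let gV : (⋀[ℂ]^4 A.LC) ≃ₗ[ℂ] (⋀[ℂ]^4 A.LC) :=
    (A.wtEquiv 2 h20 4).trans (LinearEquiv.smulOfNeZero ℂ _ _ hp4)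
  let gW : (⋀[ℂ]^b A.LC) ≃ₗ[ℂ] (⋀[ℂ]^b A.LC) :=
    (A.wtEquiv 2 h20 b).trans (LinearEquiv.smulOfNeZero ℂ _ _ hpm)
  have hgV : ∀ v, gV v = ((2 : ℂ) ^ 2)⁻¹ • A.wt 2 4 v := fun v => rfl
  have hgW : ∀ w, gW w = ((2 : ℂ) ^ (X.dim - 2))⁻¹ • A.wt 2 b w := fun w => rfl
  -- types of `tr` and `lam`
  have htr : ∀ W, trC (A.wt 2 (4 + b) W) = (2 : ℂ) ^ X.dim * trC W := fun W => by
    have h := LinearMap.congr_fun (trType_of_good hX (4 + b) 2) W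
    rw [LinearMap.comp_apply, LinearMap.smul_apply, smul_eq_mul] at h
    exact h
  have hl : ∀ W, φ' (A.wt 2 4 W) = (2 : ℂ) ^ 2 * φ' W := fun W => by
    have h := LinearMap.congr_fun (hlam 2) W
    rw [LinearMap.comp_apply, LinearMap.smul_apply, smul_eq_mul] at h
    exact h
  have hpow : (2 : ℂ) ^ X.dim = (2 : ℂ) ^ 2 * (2 : ℂ) ^ (X.dim - 2) := by
    rw [← pow_add]; congr 1; omega
  have htrC_conj : ∀ x, trC (conjK A (4 + b) x) = conj (trC x) := fun x =>
    baseC_conjK A (4 + b) (trOf X (4 + b)) x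
  have h2b : (2 : ℂ) ^ b = ((2 : ℂ) ^ (X.dim - 2)) ^ 2 := by rw [hb, pow_mul']
  have hS'wt : ∀ w w', S' (A.wt 2 b w) (A.wt 2 b w') = ((2 : ℂ) ^ (X.dim - 2)) ^ 2 * S' w w' :=
    fun w w' => h2b ▸ β_formC_wt_wt C 2 h20 b w w'
  have hP : ∀ v w, P' (gV v) (gW w) = P' v w := fun v w => by
    simp only [hgV, hgW, map_smul, LinearMap.smul_apply, smul_eq_mul]
    rw [hP'ap, hP'ap, ← Obj.wt_wedge, htr, hpow]
    field_simp
  have hSg : ∀ w w', S' (gW w) (gW w') = S' w w' := fun w w' => by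
    simp only [hgW, map_smul, LinearMap.smul_apply, smul_eq_mul]
    rw [hS'wt]
    field_simp
  have hφg : ∀ v, φ' (gV v) = φ' v := fun v => by
    simp only [hgV, map_smul, smul_eq_mul]
    rw [hl]
    field_simp
  -- Step 4: conjugation preserves the right radical; uniqueness fixes `c'`
  have hσ : ∀ w ∈ rightRad P', conjK A b w ∈ rightRad P' := by
    intro w hw
    rw [mem_rightRad_iff] at hw ⊢
    intro v
    rw [hP'ap, ← conjK_conjK A 4 v, ← conjK_wedge, htrC_conj, ← hP'ap, hw, map_zero]
  have hS' : ∀ x y, S' x y = S' y x := fun x y => β_symm (formC_symm C) x y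
  have hAni : ∀ x, S' x (conjK A b x) = 0 → x = 0 := fun x hx => eq_zero_of_β_formC_conjK C b x hx
  have hfix := IsCanonRepr.fixed (conjK A b) hσ hS' hAni hc' gV gW hP hSg hφg
  rw [hgW, inv_smul_eq_iff₀ (pow_ne_zero _ h20)] at hfix
  -- Step 5: `c` is a Hodge class
  have hof : (HodgeStructure.ofRat c : ℂ ⊗[ℚ] ↥(⋀[ℚ]^b X.L)) = (1 : ℂ) ⊗ₜ[ℚ] c := rfl
  exact A.mem_hodgeClasses_of_wt_two (m := X.dim - 2) (v := c) (by rw [hof]; exact hfix)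

end

end HodgeCM.ToyG2
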